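import Mathlib
import Summits.AnomalousDissipation.AnomalousDissipation.Theorems.MarginalStabilityChainStretchedVortexRowsStubRowVorticityConstructionToolsDecayConv
import Summits.AnomalousDissipation.AnomalousDissipation.Theorems.MarginalStabilityChainStretchedVortexRowsStubRowVorticityConstructionToolsFarU
import Summits.AnomalousDissipation.AnomalousDissipation.Theorems.MarginalStabilityChainStretchedVortexRowsStubRowVorticityConstructionToolsGreen

/-!
# Stub `stub_rowVorticityConstruction` (crux stmt-AnomalousDissipation-3009) — tools XV:
# the `tanh` parts of the velocity gradients: a period integral of `∂ₓω` vanishes, and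
# `∫ tanh · (∂_yω)(· − q) = (2π/L) ∫ sech² · ω(· − q)`

Helper file (supports stmt-AnomalousDissipation-3009). Second brick of the exponential decay package. Splitting
`K₁ = tanh(2πq₂/L) + R` (tools V), the velocity gradients `∂ₓu = −(2L)⁻¹∫K₁(∂ₓω)(· − q)`,
`∂_yu = −(2L)⁻¹∫K₁(∂_yω)(· − q)` have `R`-parts covered by tools XIV and `tanh`-PARTS handled here:

* `setIntegral_Ioc_dX_comp_sub` — `∫_{(−L/2,L/2]} (∂ₓω)(x − s, t) ds = 0` for `L`-periodic `ω ∈ C¹` (FTC over a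
  period), hence `integral_tanh_mul_dX_eq_zero`: `∫_{S_L} tanh(2πq₂/L)(∂ₓω)(x − q₁, y − q₂) dq = 0`;
* `integral_tanh_mul_dY` — `∫_{S_L} tanh(2πq₂/L)(∂_yω)(x − q₁, y − q₂) dq = (2π/L)∫_{S_L} sech²(2πq₂/L) ω(x − q₁, y − q₂) dq`
  (reflect `q₂ ↦ y − q₂`, Fubini, one IBP on every line — `∂ₜ tanh(2π(y − t)/L) = −(2π/L) sech²` — and back);
* kernel bounds for tools XIV: `|R| ≤ (4 + (20L/π)/‖q‖)e^{−2π|q₂|/L}`, `|K₂| ≤ (16 + (80L/π)/‖q‖)e^{−2π|q₂|/L}`,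
  `sech²(2πq₂/L) ≤ 4e^{−4π|q₂|/L}` on `S_L`.
Registered sub-goal proved here: `stub_rowVorticityConstruction_tanhParts`. All `[folklore]`.
-/

set_option linter.dupNamespace false

noncomputable section

open Real Set Filter Topology MeasureTheory
open Literature.Analysis.FluidPDE Literature.Analysis.FluidPDE.StretchedLayer

namespace Summit.AnomalousDissipation.AnomalousDissipation.Theorems.MarginalStabilityChainStretchedVortexRows.RowBiotSavart

/-! ### Kernel bounds on the strip -/

section KerBounds

variable {L : ℝ}

/-- `|K₁ − tanh| ≤ (4 + (20L/π)/‖q‖) e^{−2π|q₂|/L}` on the strip. [folklore] -/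
theorem abs_rowKerU_sub_tanh_le (hL : 0 < L) {q : ℝ × ℝ} (hq : q ∈ Ioc (-(L / 2)) (L / 2) ×ˢ (univ : Set ℝ)) :
    |Real.sinh (2 * π * q.2 / L) / (Real.cosh (2 * π * q.2 / L) - Real.cos (2 * π * q.1 / L)) -
        Real.sinh (2 * π * q.2 / L) / Real.cosh (2 * π * q.2 / L)| ≤
      (4 + 20 * L / π / ‖q‖) * Real.exp (-(2 * π / L) * |q.2|) := by
  rw [kerU_sub_tanh, abs_mul]
  have h1 := abs_rowKerU_le hL hq
  have habs : |2 * π * q.2 / L| = 2 * π / L * |q.2| := by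
    rw [abs_div, abs_mul, abs_of_pos hL, abs_of_pos (by positivity : (0:ℝ) < 2 * π)]; ring
  have h2 : |Real.cos (2 * π * q.1 / L) / Real.cosh (2 * π * q.2 / L)| ≤ 2 * Real.exp (-(2 * π / L) * |q.2|) := by
    rw [abs_div, abs_of_pos (Real.cosh_pos _)]
    have hc := inv_cosh_le (2 * π * q.2 / L)
    rw [habs] at hc
    calc |Real.cos (2 * π * q.1 / L)| / Real.cosh (2 * π * q.2 / L) ≤ 1 / Real.cosh (2 * π * q.2 / L) :=
          div_le_div_of_nonneg_right (Real.abs_cos_le_one _) (Real.cosh_pos _).le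
      _ ≤ 2 * Real.exp (-(2 * π / L) * |q.2|) := by rw [one_div, neg_mul]; exact hc
  calc _ ≤ (2 + 10 * L / π / ‖q‖) * (2 * Real.exp (-(2 * π / L) * |q.2|)) := mul_le_mul h1 h2 (abs_nonneg _) (by positivity)
    _ = _ := by ring

/-- `|K₂| ≤ (16 + (80L/π)/‖q‖) e^{−2π|q₂|/L}` on the strip. [folklore] -/
theorem abs_rowKerV_le_exp (hL : 0 < L) {q : ℝ × ℝ} (hq : q ∈ Ioc (-(L / 2)) (L / 2) ×ˢ (univ : Set ℝ)) :
    |Real.sin (2 * π * q.1 / L) / (Real.cosh (2 * π * q.2 / L) - Real.cos (2 * π * q.1 / L))| ≤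
      (16 + 80 * L / π / ‖q‖) * Real.exp (-(2 * π / L) * |q.2|) := by
  have habs : |2 * π * q.2 / L| = 2 * π / L * |q.2| := by
    rw [abs_div, abs_mul, abs_of_pos hL, abs_of_pos (by positivity : (0:ℝ) < 2 * π)]; ring
  have h1 := abs_rowKerV_le hL hq
  have hn : 0 ≤ 80 * L / π / ‖q‖ := by positivity
  rcases le_or_gt 2 |2 * π * q.2 / L| with ht | ht
  · have h2 := abs_kerV_le_exp (s := 2 * π * q.1 / L) ht
    rw [habs] at h2
    have he : 0 < Real.exp (-(2 * π / L * |q.2|)) := Real.exp_pos _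
    calc _ ≤ 3 * Real.exp (-(2 * π / L * |q.2|)) := h2
      _ ≤ (16 + 80 * L / π / ‖q‖) * Real.exp (-(2 * π / L) * |q.2|) := by
          rw [neg_mul]; nlinarith [mul_nonneg hn he.le]
  · have he : 1 ≤ 8 * Real.exp (-(2 * π / L) * |q.2|) := by
      rw [neg_mul, ← habs, Real.exp_neg]
      have h8 : Real.exp |2 * π * q.2 / L| ≤ 8 := by
        have := Real.exp_le_exp.2 ht.le
        have h2 : Real.exp 2 ≤ 8 := by
          rw [show (2:ℝ) = 1 + 1 by norm_num, Real.exp_add]; nlinarith [Real.exp_one_lt_d9, Real.exp_pos 1]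
        linarith
      have hp : 0 < Real.exp |2 * π * q.2 / L| := Real.exp_pos _
      rw [le_mul_inv_iff₀ hp]; linarith
    calc _ ≤ 2 + 10 * L / π / ‖q‖ := h1
      _ ≤ (2 + 10 * L / π / ‖q‖) * (8 * Real.exp (-(2 * π / L) * |q.2|)) := le_mul_of_one_le_right (by positivity) he
      _ = _ := by ring

/-- `sech²(2πt/L) ≤ 4 e^{−4π|t|/L}`. [folklore] -/
theorem sech_sq_le (hL : 0 < L) (t : ℝ) :
    1 / Real.cosh (2 * π * t / L) ^ 2 ≤ 4 * Real.exp (-(4 * π / L) * |t|) := by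
  have hc := inv_cosh_le (2 * π * t / L)
  have habs : |2 * π * t / L| = 2 * π / L * |t| := by
    rw [abs_div, abs_mul, abs_of_pos hL, abs_of_pos (by positivity : (0:ℝ) < 2 * π)]; ring
  rw [habs] at hc
  have h0 : 0 ≤ (Real.cosh (2 * π * t / L))⁻¹ := inv_nonneg.2 (Real.cosh_pos _).le
  have h1 := mul_le_mul hc hc h0 ((h0.trans hc))
  rw [one_div, ← inv_pow, sq]
  refine h1.trans (le_of_eq ?_)
  rw [show -(4 * π / L) * |t| = -(2 * π / L * |t|) + -(2 * π / L * |t|) by ring, Real.exp_add]; ring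

end KerBounds

/-! ### The `tanh` part of `∂ₓu`: a period integral of `∂ₓω` vanishes -/

section TanhX

variable {L : ℝ} {ω : ℝ → ℝ → ℝ}

/-- `∫_{(−L/2, L/2]} (∂ₓω)(x − s, t) ds = 0` for `L`-periodic `ω ∈ C¹`. [folklore] -/
theorem setIntegral_Ioc_dX_comp_sub (hL : 0 < L) (hω : ContDiff ℝ 1 fun p : ℝ × ℝ => ω p.1 p.2)
    (hper : ∀ x y, ω (x + L) y = ω x y) (x t : ℝ) : ∫ s in Ioc (-(L / 2)) (L / 2), dX ω (x - s) t = 0 := by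
  have hle : -(L / 2) ≤ L / 2 := by linarith
  rw [← intervalIntegral.integral_of_le hle]
  have hd : ∀ s, HasDerivAt (fun s => -ω (x - s) t) (dX ω (x - s) t) s := fun s => by
    have h := (HasDerivAt.comp_const_sub x s (hasDerivAt_slice_fst hω (x - s) t)).neg
    exact h.congr_deriv (neg_neg _)
  have hc : Continuous fun s => dX ω (x - s) t :=
    (continuous_dX hω).comp ((continuous_const.sub continuous_id).prodMk continuous_const)
  rw [intervalIntegral.integral_eq_sub_of_hasDerivAt (fun s _ => hd s) (hc.intervalIntegrable _ _)]
  rw [show x - -(L / 2) = x - L / 2 + L by ring, hper]; ring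

/-- **The `tanh` part of `∂ₓu` vanishes**: `∫_{S_L} tanh(2πq₂/L) (∂ₓω)(x − q₁, y − q₂) dq = 0`. [folklore] -/
theorem integral_tanh_mul_dX_eq_zero (hL : 0 < L) (hω : ContDiff ℝ 1 fun p : ℝ × ℝ => ω p.1 p.2)
    {C' a' : ℝ} (ha' : 0 < a')
    (hb' : ∀ p, ‖fderiv ℝ (fun p : ℝ × ℝ => ω p.1 p.2) p‖ ≤ C' * Real.exp (-a' * p.2 ^ 2))
    (hper : ∀ x y, ω (x + L) y = ω x y) (x y : ℝ) :
    ∫ q in Ioc (-(L / 2)) (L / 2) ×ˢ (univ : Set ℝ),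
      Real.sinh (2 * π * q.2 / L) / Real.cosh (2 * π * q.2 / L) * dX ω (x - q.1) (y - q.2) = 0 := by
  have mT : Measurable fun q : ℝ × ℝ => Real.sinh (2 * π * q.2 / L) / Real.cosh (2 * π * q.2 / L) := by fun_prop
  have gtT : ∀ c : ℝ, 0 < c → ∀ y₀ : ℝ, Integrable (fun q : ℝ × ℝ =>
      ‖Real.sinh (2 * π * q.2 / L) / Real.cosh (2 * π * q.2 / L)‖ * Real.exp (-c * (y₀ - q.2) ^ 2))
      ((volume : Measure (ℝ × ℝ)).restrict (Ioc (-(L / 2)) (L / 2) ×ˢ (univ : Set ℝ))) :=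
    gaussTestable_of_le mT (A := 1) (B := 0) (D := 0) le_rfl le_rfl fun q _ => by
      rw [abs_div, abs_of_pos (Real.cosh_pos _), Real.abs_sinh, ← Real.cosh_abs]
      have h := (div_le_one (Real.cosh_pos |2 * π * q.2 / L|)).2 (Real.sinh_lt_cosh _).le
      simpa using h
  have bX : ∀ p : ℝ × ℝ, ‖(fun p : ℝ × ℝ => dX ω p.1 p.2) p‖ ≤ C' * Real.exp (-a' * p.2 ^ 2) := fun p => by
    rw [Real.norm_eq_abs]; exact abs_dX_le hω hb' p.1 p.2
  have iT : Integrable (fun q : ℝ × ℝ => Real.sinh (2 * π * q.2 / L) / Real.cosh (2 * π * q.2 / L) *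
      dX ω (x - q.1) (y - q.2)) ((volume : Measure (ℝ × ℝ)).restrict (Ioc (-(L / 2)) (L / 2) ×ˢ (univ : Set ℝ))) := by
    have := integrable_ker_smul mT.aestronglyMeasurable gtT (continuous_dX hω) ha' bX (x, y)
    simpa only [smul_eq_mul, Prod.fst_sub, Prod.snd_sub] using this
  rw [volume_restrict_strip] at iT ⊢
  rw [integral_prod_symm _ iT]
  have : ∀ t : ℝ, (∫ s in Ioc (-(L / 2)) (L / 2), Real.sinh (2 * π * t / L) / Real.cosh (2 * π * t / L) *
      dX ω (x - s) (y - t)) = 0 := fun t => by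
    rw [integral_const_mul, setIntegral_Ioc_dX_comp_sub hL hω hper, mul_zero]
  simp_rw [this]
  simp

end TanhX

/-! ### The `tanh` part of `∂_yu`: one integration by parts onto `sech²` -/

section TanhY

variable {L : ℝ} {ω : ℝ → ℝ → ℝ}

/-- `∂ₜ tanh(2π(y − t)/L) = −(2π/L) sech²(2π(y − t)/L)`. [folklore] -/
theorem hasDerivAt_tanh_reflect (L y t : ℝ) :
    HasDerivAt (fun t => Real.sinh (2 * π * (y - t) / L) / Real.cosh (2 * π * (y - t) / L))
      (1 / Real.cosh (2 * π * (y - t) / L) ^ 2 * (-(2 * π / L))) t := by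
  have hθ : HasDerivAt (fun t : ℝ => 2 * π * (y - t) / L) (-(2 * π / L)) t := by
    have := (((hasDerivAt_id' t).const_sub y).const_mul (2 * π)).div_const L
    refine this.congr_deriv ?_; ring
  have hq : ∀ θ : ℝ, HasDerivAt (fun θ => Real.sinh θ / Real.cosh θ) (1 / Real.cosh θ ^ 2) θ := fun θ => by
    have h := (Real.hasDerivAt_sinh θ).div (Real.hasDerivAt_cosh θ) (Real.cosh_pos θ).ne'
    refine h.congr_deriv ?_
    have hc : Real.cosh θ ^ 2 ≠ 0 := (pow_pos (Real.cosh_pos θ) 2).ne'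
    rw [div_eq_div_iff hc hc]
    nlinarith [Real.cosh_sq θ]
  exact (hq _).comp t hθ

/-- **The `tanh` part of `∂_yu`**: for `ω ∈ C¹` with Gaussian bounds on `ω, Dω`,
`∫_{S_L} tanh(2πq₂/L)(∂_yω)(x − q₁, y − q₂) dq = (2π/L) ∫_{S_L} sech²(2πq₂/L) ω(x − q₁, y − q₂) dq`. [folklore] -/
theorem integral_tanh_mul_dY (hL : 0 < L) (hω : ContDiff ℝ 1 fun p : ℝ × ℝ => ω p.1 p.2) {C a C' a' : ℝ}
    (ha : 0 < a) (hb : ∀ x y, |ω x y| ≤ C * Real.exp (-a * y ^ 2)) (ha' : 0 < a')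
    (hb' : ∀ p, ‖fderiv ℝ (fun p : ℝ × ℝ => ω p.1 p.2) p‖ ≤ C' * Real.exp (-a' * p.2 ^ 2)) (x y : ℝ) :
    ∫ q in Ioc (-(L / 2)) (L / 2) ×ˢ (univ : Set ℝ),
        Real.sinh (2 * π * q.2 / L) / Real.cosh (2 * π * q.2 / L) * dY ω (x - q.1) (y - q.2) =
      2 * π / L * ∫ q in Ioc (-(L / 2)) (L / 2) ×ˢ (univ : Set ℝ),
        1 / Real.cosh (2 * π * q.2 / L) ^ 2 * ω (x - q.1) (y - q.2) := by
  have hC : 0 ≤ C := by have := (abs_nonneg _).trans (hb 0 0); simpa using this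
  have hC' : 0 ≤ C' := by have := (norm_nonneg _).trans (hb' 0); simpa using this
  rw [setIntegral_strip_reflect_snd L (fun t => Real.sinh (2 * π * t / L) / Real.cosh (2 * π * t / L)) (dY ω) x y,
    setIntegral_strip_reflect_snd L (fun t => 1 / Real.cosh (2 * π * t / L) ^ 2) ω x y]
  -- integrability of the reflected integrands
  have cY := continuous_dY hω
  have hT1 : ∀ s : ℝ, |Real.sinh s / Real.cosh s| ≤ 1 := fun s => by
    rw [abs_div, abs_of_pos (Real.cosh_pos _), Real.abs_sinh, ← Real.cosh_abs]
    exact (div_le_one (Real.cosh_pos _)).2 (Real.sinh_lt_cosh _).le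
  have hS1 : ∀ s : ℝ, |1 / Real.cosh s ^ 2| ≤ 1 := fun s => by
    rw [abs_of_pos (by positivity), div_le_one (by positivity)]
    nlinarith [Real.one_le_cosh s]
  have iL : Integrable (fun q : ℝ × ℝ => Real.sinh (2 * π * (y - q.2) / L) / Real.cosh (2 * π * (y - q.2) / L) *
      dY ω (x - q.1) q.2) ((volume : Measure (ℝ × ℝ)).restrict (Ioc (-(L / 2)) (L / 2) ×ˢ (univ : Set ℝ))) := by
    have h1 := integrable_strip_of_snd L ((integrable_exp_neg_mul_sq ha').const_mul C')
    refine h1.mono' ?_ (Eventually.of_forall fun q => ?_)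
    · exact ((Continuous.div (by fun_prop) (by fun_prop) (fun q => (Real.cosh_pos _).ne') :
        Continuous fun q : ℝ × ℝ => Real.sinh (2 * π * (y - q.2) / L) /
        Real.cosh (2 * π * (y - q.2) / L)).mul (cY.comp ((continuous_const.sub continuous_fst).prodMk
        continuous_snd))).aestronglyMeasurable
    · rw [norm_mul, Real.norm_eq_abs, Real.norm_eq_abs]
      calc _ ≤ 1 * |dY ω (x - q.1) q.2| := mul_le_mul_of_nonneg_right (hT1 _) (abs_nonneg _)
        _ ≤ _ := by rw [one_mul]; exact abs_dY_le hω hb' _ _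
  have iR : Integrable (fun q : ℝ × ℝ => 1 / Real.cosh (2 * π * (y - q.2) / L) ^ 2 * ω (x - q.1) q.2)
      ((volume : Measure (ℝ × ℝ)).restrict (Ioc (-(L / 2)) (L / 2) ×ˢ (univ : Set ℝ))) := by
    have h1 := integrable_strip_of_snd L ((integrable_exp_neg_mul_sq ha).const_mul C)
    refine h1.mono' ?_ (Eventually.of_forall fun q => ?_)
    · exact ((Continuous.div continuous_const (by fun_prop) fun q => by positivity :
        Continuous fun q : ℝ × ℝ => 1 / Real.cosh (2 * π * (y - q.2) / L) ^ 2).mul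
        (hω.continuous.comp ((continuous_const.sub continuous_fst).prodMk continuous_snd))).aestronglyMeasurable
    · rw [norm_mul, Real.norm_eq_abs, Real.norm_eq_abs]
      calc _ ≤ 1 * |ω (x - q.1) q.2| := mul_le_mul_of_nonneg_right (hS1 _) (abs_nonneg _)
        _ ≤ _ := by rw [one_mul]; exact hb _ _
  rw [volume_restrict_strip] at iL iR ⊢
  rw [integral_prod _ iL, integral_prod _ iR, ← integral_const_mul]
  refine integral_congr_ae (Eventually.of_forall fun q₁ => ?_)
  -- one IBP on the line `{q₁} × ℝ`
  show (∫ t, Real.sinh (2 * π * (y - t) / L) / Real.cosh (2 * π * (y - t) / L) * dY ω (x - q₁) t) =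
    2 * π / L * ∫ t, 1 / Real.cosh (2 * π * (y - t) / L) ^ 2 * ω (x - q₁) t
  set U : ℝ → ℝ := fun t => Real.sinh (2 * π * (y - t) / L) / Real.cosh (2 * π * (y - t) / L)
  set U' : ℝ → ℝ := fun t => 1 / Real.cosh (2 * π * (y - t) / L) ^ 2 * (-(2 * π / L))
  set V : ℝ → ℝ := fun t => ω (x - q₁) t
  set V' : ℝ → ℝ := fun t => dY ω (x - q₁) t
  have hU : ∀ t, HasDerivAt U (U' t) t := fun t => hasDerivAt_tanh_reflect L y t
  have hV : ∀ t, HasDerivAt V (V' t) t := fun t => hasDerivAt_slice_snd hω (x - q₁) t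
  have bU : ∀ t, |U t| ≤ 1 + 0 * |t| := fun t => by simpa using hT1 (2 * π * (y - t) / L)
  have bU' : ∀ t, |U' t| ≤ 2 * π / L + 0 * |t| := fun t => by
    simp only [U', abs_mul, abs_neg, abs_of_pos (by positivity : (0:ℝ) < 2 * π / L), zero_mul, add_zero]
    have h1 := hS1 (2 * π * (y - t) / L)
    have h2 : 0 < 2 * π / L := by positivity
    nlinarith [abs_nonneg (1 / Real.cosh (2 * π * (y - t) / L) ^ 2)]
  have bV : ∀ t, |V t| ≤ C * Real.exp (-a * (0 - t) ^ 2) := fun t => by simpa using hb (x - q₁) t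
  have bV' : ∀ t, |V' t| ≤ C' * Real.exp (-a' * (0 - t) ^ 2) := fun t => by simpa using abs_dY_le hω hb' (x - q₁) t
  have mU : AEStronglyMeasurable U := (by fun_prop : Measurable U).aestronglyMeasurable
  have mU' : AEStronglyMeasurable U' := (by fun_prop : Measurable U').aestronglyMeasurable
  have mV : AEStronglyMeasurable V := (hω.continuous.comp (continuous_const.prodMk continuous_id)).aestronglyMeasurable
  have mV' : AEStronglyMeasurable V' := (cY.comp (continuous_const.prodMk continuous_id)).aestronglyMeasurable
  have prod : ∀ {P Q : ℝ → ℝ} {a₀ K b₀ : ℝ}, AEStronglyMeasurable P → AEStronglyMeasurable Q → 0 < b₀ → 0 ≤ K →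
      (∀ t, |P t| ≤ a₀ + 0 * |t|) → (∀ t, |Q t| ≤ K * Real.exp (-b₀ * (0 - t) ^ 2)) → Integrable (P * Q) := by
    intro P Q a₀ K b₀ mP mQ hb₀ hK hP hQ
    refine integrable_of_abs_le_affine_mul_gauss (mP.mul mQ) hb₀ hK (A := a₀) (B := 0) (y := 0) fun t => ?_
    rw [Pi.mul_apply, abs_mul]
    exact mul_le_mul (hP t) (hQ t) (abs_nonneg _) ((abs_nonneg _).trans (hP t))
  have i1 : Integrable (U * V') := prod mU mV' ha' hC' bU bV'
  have i2 : Integrable (U' * V) := prod mU' mV ha hC bU' bV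
  have i3 : Integrable (U * V) := prod mU mV ha hC bU bV
  have h := integral_mul_deriv_eq_deriv_mul_of_integrable (fun t _ => hU t) (fun t _ => hV t) i1 i2 i3
  rw [h, ← integral_neg, ← integral_const_mul]
  refine integral_congr_ae (Eventually.of_forall fun t => ?_)
  simp only [U', V]; ring

end TanhY

end RowBiotSavart

open RowBiotSavart in
/-- **The `tanh` parts of the velocity gradients** (registered on stmt-AnomalousDissipation-3009 as the helper stub
`stub_rowVorticityConstruction_tanhParts` of `stub_rowVorticityConstruction`): for `L > 0` and an `L`-periodic
`ω ∈ C¹` with Gaussian bounds on `ω` and `Dω`, `∫_{S_L} tanh(2πq₂/L)(∂ₓω)(x − q₁, y − q₂) dq = 0` and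
`∫_{S_L} tanh(2πq₂/L)(∂_yω)(x − q₁, y − q₂) dq = (2π/L)∫_{S_L} sech²(2πq₂/L) ω(x − q₁, y − q₂) dq`
(`RowBiotSavart.integral_tanh_mul_dX_eq_zero`, `integral_tanh_mul_dY`). [folklore] -/
theorem stub_rowVorticityConstruction_tanhParts :
    ∀ (L : ℝ) (ω : ℝ → ℝ → ℝ) (C a C' a' : ℝ), 0 < L → ContDiff ℝ 1 (fun p : ℝ × ℝ => ω p.1 p.2) → 0 < a →
      (∀ x y, |ω x y| ≤ C * Real.exp (-a * y ^ 2)) → 0 < a' →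
      (∀ p : ℝ × ℝ, ‖fderiv ℝ (fun p : ℝ × ℝ => ω p.1 p.2) p‖ ≤ C' * Real.exp (-a' * p.2 ^ 2)) →
      (∀ x y, ω (x + L) y = ω x y) → ∀ x y : ℝ,
        (∫ q in Set.Ioc (-(L / 2)) (L / 2) ×ˢ (Set.univ : Set ℝ),
            Real.sinh (2 * Real.pi * q.2 / L) / Real.cosh (2 * Real.pi * q.2 / L) * dX ω (x - q.1) (y - q.2)) = 0 ∧
        (∫ q in Set.Ioc (-(L / 2)) (L / 2) ×ˢ (Set.univ : Set ℝ),
            Real.sinh (2 * Real.pi * q.2 / L) / Real.cosh (2 * Real.pi * q.2 / L) * dY ω (x - q.1) (y - q.2)) =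
          2 * Real.pi / L * ∫ q in Set.Ioc (-(L / 2)) (L / 2) ×ˢ (Set.univ : Set ℝ),
            1 / Real.cosh (2 * Real.pi * q.2 / L) ^ 2 * ω (x - q.1) (y - q.2) :=
  fun _ _ _ _ _ _ hL hω ha hb ha' hb' hper x y =>
    ⟨integral_tanh_mul_dX_eq_zero hL hω ha' hb' hper x y, integral_tanh_mul_dY hL hω ha hb ha' hb' x y⟩

end Summit.AnomalousDissipation.AnomalousDissipation.Theorems.MarginalStabilityChainStretchedVortexRows

end
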